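import Summits.BirchSwinnertonDyer.BirchSwinnertonDyer.Theses.KatoDescentTamePotSupersingular
import Summits.BirchSwinnertonDyer.BirchSwinnertonDyer.Theorems.KatoDescentPotSupersingularMemberHullZetaInputsOfCore
import Summits.BirchSwinnertonDyer.BirchSwinnertonDyer.Theorems.KatoDescentPotSupersingularReducibleKatoMemberZetaInputsDescent
import HarnessLib

/-!
# Route `KatoDescentTamePotSupersingular` (rung K8-t′, cell `bsd-potss`): the gen-4 GLUE of the shared crux M `ReducibleKatoMember`
# (item stmt-BirchSwinnertonDyer-19196) — item stmt-BirchSwinnertonDyer-27964 `ReducibleKatoMemberOfCoreInputs`, BY NAME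
# (planner g28 TARGET R265 resplit, 2026-08-28T13:27Z; seat `bsd-potss-rkm` g22)

WHAT.  `reducibleKatoMemberOfCoreInputs_glue : ReducibleKatoMemberOfCoreInputs` — the route decl VERBATIM, i.e.
`PublishedInputNewformKatoZ → PublishedInputMemberHullZetaCore → HeldPoitouTateSelmerDualityQ → PublishedInputRankEqAnalyticRankZ →
ReducibleKatoMember`: modularity, Kato's CORE member package `Kato2004.exists_memberHullZetaCoreInputs` (p630270; (b′) zeta-line index at
`p` in the pairing form, (c2′) the order of `𝐇²/X𝐇²`), Poitou–Tate duality for Selmer structures over `ℚ`, Gross–Zagier–Kolyvagin ⟹ crux M.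
The four aliases unfold by `rfl` to the named constants; the proof is seat rkm g21's composition: the core fact gives the zeta fact
(`MemberHullZetaInputsOfCore.exists_memberHullZetaInputs_of_coreInputs`, Kato Thm. 14.5 (2) + Prop. 14.16 (2) re-derived from (b′), (c2′)
and Poitou–Tate), then rkm g13's route-free node `ZetaInputsDescent.katoMemberShaBoundOfReducible_of_newform_of_zetaInputs`.  (g21's typed
closer `tameReducibleKatoMember_of_newformZT_of_coreInputs` was keyed to the retired gen-3 aliases `…ZT`; this file re-types it at the gen-4
decls.)  HONEST FRAMING: this closes the GLUE item only; the held children 20296 / 27962 / 27963 / 20298 stay OPEN (cite-level published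
inputs, no `_holds` expected); crux M is NOT proved unconditionally; nothing is booked; BSD is not advanced.

References: K. Kato, Astérisque 295 (2004), Thm. 12.5/12.6, Lemma 13.10 (1), Thm. 14.5 (2), (14.9.3), (14.14.1)–(14.14.2), Prop. 14.16 (2),
Lemma 14.18 [Kato2004Asterisque]; C.-H. Kim, AJM 148 §3.2.3 [Kim2022StructureSelmer]; J. S. Milne, *ADT* I Thm. 4.10 [MilneADT2006];
H. Darmon, CBMS 101 Thm. 3.22 [Darmon2004].
-/

set_option autoImplicit false
-- sibling precedent: the directory name repeats the summit name
set_option linter.dupNamespace false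

noncomputable section

namespace Summit.BirchSwinnertonDyer.BirchSwinnertonDyer.Theorems

open Literature.NumberTheory.EllipticCurves Literature.NumberTheory.EllipticCurves.ModularForms
  Literature.NumberTheory.EllipticCurves.Kato2004 Literature.NumberTheory.GaloisCohomology
open Summit.BirchSwinnertonDyer.BirchSwinnertonDyer.Theses.KatoDescentTamePotSupersingular

/-- **Glue item stmt-BirchSwinnertonDyer-27964 on K8-t′, by name**: `ReducibleKatoMemberOfCoreInputs`, i.e.
`PublishedInputNewformKatoZ → PublishedInputMemberHullZetaCore → HeldPoitouTateSelmerDualityQ → PublishedInputRankEqAnalyticRankZ →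
ReducibleKatoMember` (modularity; Kato's core member package; Poitou–Tate; Gross–Zagier–Kolyvagin ⟹ crux M).  The aliases unfold by `rfl`;
the composition is `exists_memberHullZetaInputs_of_coreInputs` followed by `katoMemberShaBoundOfReducible_of_newform_of_zetaInputs`.
[cite: Kato2004Asterisque, Thm. 14.5 (2) (p. 236), (14.9.3) (p. 240), (14.14.2) (p. 243), Prop. 14.16 (2) (pp. 244–245), Lemma 14.18 (pp. 247–248)]
[cite: Kim2022StructureSelmer, §3.2.3] [cite: MilneADT2006, Ch. I, Thm. 4.10 (b)] [cite: Darmon2004, Thm. 3.22] -/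
theorem reducibleKatoMemberOfCoreInputs_glue :
    Summit.BirchSwinnertonDyer.BirchSwinnertonDyer.Theses.KatoDescentTamePotSupersingular.ReducibleKatoMemberOfCoreInputs :=
  fun hN hC hPT hG =>
    ZetaInputsDescent.katoMemberShaBoundOfReducible_of_newform_of_zetaInputs hN
      (MemberHullZetaInputsOfCore.exists_memberHullZetaInputs_of_coreInputs hG hPT hC)

end Summit.BirchSwinnertonDyer.BirchSwinnertonDyer.Theorems

end
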